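import Summits.CriticalPhenomena.PercolationContinuityZ3.Theorems.Transplant.PlanarSkeletonFrmScaledRayStrict
import Summits.CriticalPhenomena.PercolationContinuityZ3.Theorems.Transplant.CayleyScaledCentralCustomers
import HarnessLib

/-!
# Scaled Φ2 port, XVIII′: the PAYOFF — `θ(p_c) = 0` on EVERY Cayley graph (every finite generating set) of every `CayleyScaled` group, modulo
# the one-type scaled node ALONE (Φ2 discharged by `PlanarSkeletonFrmScaled.cylSubcritical_criticalProb`)

builds on p205010 (kernel theorem, internal audit signed; external expert review pending) — nothing in this file uses p205010.  Every theorem below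
is CONDITIONAL on the OPEN node `SamePDropOfSkeletonFrmScaled₁` (hypothesis `hN` / `hD`; nothing is claimed about it) and on NOTHING ELSE.
Lane `prim-bschramm`, seat `prim-bschramm-p4` gen 16 (PART C3 of `P4-GENERAL.md` §38.5).  Helper file (`--supports stmt-CriticalPhenomena-4575 --as helper`).

Gen 16's conditional theorems carried a Φ2 hypothesis `hC : CylSubcritical (p_c)` wherever neither a tube-Lipschitz height (quasi-line kernels:
`ℤ²`, `ℤ³`, `H₃(ℤ)`) nor a central element off the kernel (Martineau–Severo: `ℤ^d`, `H₃(ℤ) × ℤ`) was available — the "centre inside the kernel"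
groups (`N_{m,c}` with `m ≥ 3` or `c ≥ 3`, …).  XVII′ proves Φ2 for EVERY `PlanarSkeletonFrmScaled` (Aizenman–Grimmett with ray columns by
`N`-steps and corner runs), so `hC` is discharged uniformly:
* `continuity_of_frmScaledNode₁_ray` — every connected locally finite graph with a ONE-type `PlanarSkeletonFrmScaled`: `θ_v(p_c) = 0` at every
  vertex, modulo the node alone; **`samePDropOfSkeletonFrmScaled₁_iff_continuity`** — the node's NORMAL FORM: it is equivalent to exactly that
  continuity statement (no hidden hypothesis left in its body);
* **`CayleyScaled.criticalContinuity`** — EVERY Cayley graph `Cay(Γ; S)`, `S` ANY finite generating set, of a group with a homomorphism to `ℤ²` of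
  rank-2 image and finitely generated kernel: `θ_g(p_c) = 0` (and `θ_g(p) = 0` for `p ≤ p_c`), modulo the node alone — INPUT(Cay(Γ; S)) says
  NOTHING about `S`;
* customers: every `CayleyFrm₃` group, every finitely generated nilpotent `NilFrm.Data` group, the free nilpotent groups `N_{m+2,c+1}` of EVERY
  rank and class — EVERY finite generating set (`CayleyFrm₃.criticalContinuity_anyGens`, `NilFrm.Data.criticalContinuity_anyGens`,
  `FreeNilClass.anyGens_criticalContinuity`).
[cite: BenjaminiSchramm1996, Conj. 4; §2 (Cayley graphs)] [cite: AizenmanGrimmett1991, Thm 1 (essential enhancements)]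
[cite: KozmaNitzan2024, §1 p. 2 (approach 1)] [cite: GrimmettPercolation1999, §12.1 p. 349]
-/

noncomputable section

namespace Summit.CriticalPhenomena.PercolationContinuityZ3.Theorems.Transplant

open SimpleGraph Subgroup Literature.Probability.LatticeModels Literature.Probability.Percolation
open scoped Classical

/-! ## §1 The interface level -/

/-- **Conditional continuity from the scaled node ALONE**: a connected locally finite graph with a one-type `PlanarSkeletonFrmScaled` has
`θ_v(p_c) = 0` at every vertex — Φ2 is now a theorem (`cylSubcritical_criticalProb`), connectivity comes from the skeleton.
[cite: BenjaminiSchramm1996, Conj. 4] [cite: AizenmanGrimmett1991, Thm 1 (essential enhancements)] -/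
theorem continuity_of_frmScaledNode₁_ray (hD : SamePDropOfSkeletonFrmScaled₁) {V : Type} (G : SimpleGraph V) [G.LocallyFinite]
    (Φ : PlanarSkeletonFrmScaled G) (t : V) (ht : t ∈ Φ.types) (h1 : Φ.types = {t}) (v : V) : theta G v (criticalProbIOf G v) = 0 :=
  continuity_of_frmScaledNode₁' hD G Φ (Φ.graph_connected ht) t ht h1 (Φ.cylSubcritical_criticalProb t) v

/-- **NORMAL FORM OF THE NODE (no hidden hypothesis left)**: `SamePDropOfSkeletonFrmScaled₁` is EQUIVALENT to Benjamini–Schramm continuity for connected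
locally finite graphs carrying a one-type `PlanarSkeletonFrmScaled` — `p_c < 1`, uniqueness and Φ2, which the node's body takes as hypotheses, are all theorems
of the interface now. [cite: BenjaminiSchramm1996, Conj. 4] [cite: AizenmanGrimmett1991, Thm 1 (essential enhancements)] -/
theorem samePDropOfSkeletonFrmScaled₁_iff_continuity : SamePDropOfSkeletonFrmScaled₁ ↔
    ∀ {V : Type} [DecidableEq V] [Countable V] (G : SimpleGraph V) [G.LocallyFinite] (Φ : PlanarSkeletonFrmScaled G),
      G.Connected → ∀ t ∈ Φ.types, Φ.types = {t} → theta G t (criticalProbIOf G t) = 0 := by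
  constructor
  · intro hD V _ _ G _ Φ hc t ht h1
    exact continuity_of_frmScaledNode₁ hD G Φ hc t ht h1 (Φ.cylSubcritical_criticalProb t)
  · intro hK
    refine samePDropOfSkeletonFrmScaled₁_iff_critical.2 ?_
    intro V _ _ G _ Φ hc t ht h1 _ _ _
    exact hK G Φ hc t ht h1

/-! ## §2 Every Cayley graph of a `CayleyScaled` group -/

namespace CayleyScaled

variable {Γ : Type} [Group Γ] {S : Finset Γ}

/-- **Φ2 at `p_c` for the scaled Cayley skeleton** — a theorem now, for every `S`. [cite: AizenmanGrimmett1991, Thm 1 (essential enhancements)] -/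
theorem cylSubcritical_criticalProb (C : CayleyScaled Γ S) :
    C.skeletonFrmScaled.CylSubcritical (criticalProbIOf (mulCayley (↑S : Set Γ)) (1 : Γ)) :=
  C.skeletonFrmScaled.cylSubcritical_criticalProb 1

/-- **THEOREM (modulo the scaled node ALONE): `θ_g(p) = 0` for every `p ≤ p_c` on `Cay(Γ; S)`** — `S` ANY finite generating set of a group with
a rank-2 homomorphism to `ℤ²` with finitely generated kernel. [cite: BenjaminiSchramm1996, Conj. 4; §2] -/
theorem theta_eq_zero_of_le (C : CayleyScaled Γ S) (hN : SamePDropOfSkeletonFrmScaled₁) (g : Γ) {p : unitInterval}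
    (hp : (p : ℝ) ≤ criticalProb (mulCayley (↑S : Set Γ)) g) : theta (mulCayley (↑S : Set Γ)) g p = 0 :=
  C.theta_eq_zero_of_le_of_frmScaledNode₁ hN C.cylSubcritical_criticalProb g hp

/-- **THEOREM (modulo the scaled node ALONE): `θ_g(p_c) = 0` on `Cay(Γ; S)` at every vertex** — `S` ANY finite generating set.
[cite: BenjaminiSchramm1996, Conj. 4; §2] -/
theorem criticalContinuity (C : CayleyScaled Γ S) (hN : SamePDropOfSkeletonFrmScaled₁) (g : Γ) :
    theta (mulCayley (↑S : Set Γ)) g (criticalProbIOf (mulCayley (↑S : Set Γ)) g) = 0 :=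
  C.criticalContinuity_of_frmScaledNode₁ hN C.cylSubcritical_criticalProb g

end CayleyScaled

/-! ## §3 Customers: every alphabet of every `CayleyFrm₃` / nilpotent `NilFrm.Data` group, the free nilpotent groups -/

namespace CayleyFrm₃

variable {Γ : Type} [Group Γ] {S₀ : Finset Γ}

/-- **`θ_g(p_c) = 0` on `Cay(Γ; S')` for EVERY finite generating `S'`** of a group carrying a `CayleyFrm₃` (on some alphabet) — modulo the scaled
node ALONE. [cite: BenjaminiSchramm1996, Conj. 4; §2] -/
theorem criticalContinuity_anyGens (C : CayleyFrm₃ Γ S₀) (hN : SamePDropOfSkeletonFrmScaled₁) (S' : Finset Γ)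
    (hS' : Subgroup.closure (S' : Set Γ) = ⊤) (g : Γ) : theta (mulCayley (↑S' : Set Γ)) g (criticalProbIOf (mulCayley (↑S' : Set Γ)) g) = 0 :=
  (C.scaledOf S' hS').criticalContinuity hN g

/-- … and `θ_g(p) = 0` for every `p ≤ p_c`. [cite: BenjaminiSchramm1996, Conj. 4; §2] -/
theorem theta_eq_zero_anyGens (C : CayleyFrm₃ Γ S₀) (hN : SamePDropOfSkeletonFrmScaled₁) (S' : Finset Γ)
    (hS' : Subgroup.closure (S' : Set Γ) = ⊤) (g : Γ) {p : unitInterval} (hp : (p : ℝ) ≤ criticalProb (mulCayley (↑S' : Set Γ)) g) :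
    theta (mulCayley (↑S' : Set Γ)) g p = 0 :=
  (C.scaledOf S' hS').theta_eq_zero_of_le hN g hp

end CayleyFrm₃

namespace NilFrm.Data

variable {Γ : Type} [Group Γ]

/-- **Every finitely generated nilpotent `NilFrm.Data` group, EVERY finite generating set `S'`: `θ_g(p_c) = 0` on `Cay(Γ; S')`** — modulo the
scaled node ALONE (the Φ2 hypothesis of `criticalContinuity_anyGens_of_frmScaledNode₁` discharged). [cite: BenjaminiSchramm1996, Conj. 4; §2]
[cite: KozmaNitzan2024, §1 p. 2 (approach 1)] -/
theorem criticalContinuity_anyGens (D : NilFrm.Data Γ) (hN : SamePDropOfSkeletonFrmScaled₁) (S' : Finset Γ)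
    (hS' : Subgroup.closure (S' : Set Γ) = ⊤) (g : Γ) : theta (mulCayley (↑S' : Set Γ)) g (criticalProbIOf (mulCayley (↑S' : Set Γ)) g) = 0 :=
  (D.scaledOf S' hS').criticalContinuity hN g

/-- … and `θ_g(p) = 0` for every `p ≤ p_c`. [cite: BenjaminiSchramm1996, Conj. 4; §2] -/
theorem theta_eq_zero_anyGens (D : NilFrm.Data Γ) (hN : SamePDropOfSkeletonFrmScaled₁) (S' : Finset Γ)
    (hS' : Subgroup.closure (S' : Set Γ) = ⊤) (g : Γ) {p : unitInterval} (hp : (p : ℝ) ≤ criticalProb (mulCayley (↑S' : Set Γ)) g) :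
    theta (mulCayley (↑S' : Set Γ)) g p = 0 :=
  (D.scaledOf S' hS').theta_eq_zero_of_le hN g hp

end NilFrm.Data

namespace FreeNilClass

/-- **The free nilpotent group `N_{m+2,c+1}` of EVERY rank and class, EVERY finite generating set `S'`: `θ_g(p_c) = 0` on `Cay(N; S')`** — modulo
the scaled node ALONE (centre inside the kernel no longer an obstruction: Φ2 by rays).
builds on p205010 (kernel theorem, internal audit signed; external expert review pending). [cite: BenjaminiSchramm1996, Conj. 4; §2] -/
theorem anyGens_criticalContinuity (m c : ℕ) (hN : SamePDropOfSkeletonFrmScaled₁) (S' : Finset (N m c))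
    (hS' : Subgroup.closure (S' : Set (N m c)) = ⊤) (g : N m c) :
    theta (mulCayley (↑S' : Set (N m c))) g (criticalProbIOf (mulCayley (↑S' : Set (N m c))) g) = 0 :=
  (cayleyFrm₃ m c).criticalContinuity_anyGens hN S' hS' g

/-- … and `θ_g(p) = 0` for every `p ≤ p_c`. [cite: BenjaminiSchramm1996, Conj. 4; §2] -/
theorem anyGens_theta_eq_zero (m c : ℕ) (hN : SamePDropOfSkeletonFrmScaled₁) (S' : Finset (N m c))
    (hS' : Subgroup.closure (S' : Set (N m c)) = ⊤) (g : N m c) {p : unitInterval}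
    (hp : (p : ℝ) ≤ criticalProb (mulCayley (↑S' : Set (N m c))) g) : theta (mulCayley (↑S' : Set (N m c))) g p = 0 :=
  (cayleyFrm₃ m c).theta_eq_zero_anyGens hN S' hS' g hp

end FreeNilClass

end Summit.CriticalPhenomena.PercolationContinuityZ3.Theorems.Transplant

end
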